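import Literature.Analysis.FluidPDE.MikadoDirectionFamilies
import HarnessLib

/-!
# Geometric Lemma I for each of the 27 rotated six-direction families (De Lellis–Kwon 2022, §3.4.2:
# "applying Lemma 3.2 just 27 times")

Analysis/FluidPDE support file on the discharge path of `Torus.DeLellisKwon2022_thm11`
(everything proved; no named facts). De Lellis–Kwon, Anal. PDE 15 (2022) = arXiv:2006.06482, §3.4.2,
choose the Reynolds weights `γ_I = δ_{q+1}^{1/2} Γ_I`, `Γ_I = Γ_{f_I}(Id - δ_{q+1}⁻¹ 𝓜_I)`, by applying
the six-direction Geometric Lemma I (Lemma 3.2) to each family `𝓕^{[n],R} = {A_j fᵢ}` — "this means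
applying Lemma 3.2 just 27 times". `SixDirectionGeometricLemma` proves Lemma 3.2 for the base family
`{fᵢ} = {(1,±1,0),(1,0,±1),(0,1,±1)}` with EXPLICIT coordinate functionals `Lᵢ = DLK.sixCoeffSq`; this
file transports it to the 27 families `{A_j fᵢ}` of `MikadoDirectionFamilies` (`A_j A_jᵀ = n_j² Id`)
through the congruence `M ↦ A_jᵀ M A_j`:

* `DLK.famDir j i = A_j fᵢ ∈ ℝ³` (the real vector of `DLK.dir (j, i)`, `i < 6`);
* `DLK.cong j M = A_jᵀ M A_j` and `DLK.famCoeffSq j M i = Lᵢ(A_jᵀ M A_j) / n_j⁴` — LINEAR in `M`;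
* `DLK.fam_identity` — **`M_ab = ∑ᵢ famCoeffSq j M i (A_j fᵢ)_a (A_j fᵢ)_b` for every symmetric `M`**
  (since `A_j (A_jᵀ M A_j) A_jᵀ = n_j⁴ M` and `A_jᵀ M A_j = ∑ Lᵢ fᵢ ⊗ fᵢ`);
* `DLK.famCoeffSq_idMat` — `famCoeffSq j Id i = 1/(4 n_j²)` (`= 1/C_j`, `C_j = 4n_j²`), and the
  Lipschitz bound `|famCoeffSq j M i - 1/(4n_j²)| ≤ (5K_j/(4n_j⁴)) |M - Id|_∞` (`DLK.abs_famCoeffSq_sub_le`,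
  `K_j = (∑_{ab} |(A_j)_{ab}|)²`, `DLK.congConst`), whence `famCoeffSq ≥ 1/(8n_j²)` on the sup-ball of radius
  `ρ_j = n_j²/(10K_j)` (`DLK.famRadius`, `DLK.le_famCoeffSq`), positivity and smooth square roots
  `DLK.famCoeff` on the open sup-ball of radius `2ρ_j` (`DLK.famCoeff_pos`, `DLK.contDiffOn_famCoeff`,
  `DLK.fam_decomposition`, `DLK.exists_bound_iteratedFDeriv_famCoeff`) — the functions `Γ_{f_I}` of
  §3.4.2 for `I ∈ 𝓘_R`.

## References

* C. De Lellis, H. Kwon, Anal. PDE 15 (2022) = arXiv:2006.06482, Lemma 3.2 and §3.4.2. [DelellisKwon2022]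
-/

noncomputable section

open Set Metric Function Matrix
open scoped ContDiff

namespace Literature.Analysis.FluidPDE

namespace DLK

open NashGeometric

variable (j : Fin 27)

/-- The real matrix `A_j`. [folklore] -/
def rotR (a b : Fin 3) : ℝ := (rot j a b : ℝ)

/-- The real scale `n_j` (positive). [folklore] -/
def scaleR : ℝ := (rotScale j : ℝ)

/-- `n_j > 0`. [folklore] -/
theorem scaleR_pos : 0 < scaleR j := by
  unfold scaleR; exact_mod_cast rotScale_pos j

/-- **`A_j A_jᵀ = n_j² Id` over `ℝ`, entrywise**: `∑_{a'} A a a' A c a' = n² δ_{ac}`. [folklore] -/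
theorem sum_rotR_mul_rotR (a c : Fin 3) :
    ∑ a', rotR j a a' * rotR j c a' = scaleR j ^ 2 * (if a = c then 1 else 0) := by
  have h := congrFun (congrFun (rot_mul_transpose j) a) c
  rw [Matrix.mul_apply, Matrix.smul_apply, Matrix.one_apply] at h
  simp only [Matrix.transpose_apply, smul_eq_mul] at h
  have h' : ((∑ a', rot j a a' * rot j c a' : ℤ) : ℝ) = ((rotScale j ^ 2 * (if a = c then 1 else 0) : ℤ) : ℝ) := by
    exact_mod_cast h
  push_cast at h'
  simpa [rotR, scaleR] using h'

/-- **`A_jᵀ A_j = n_j² Id` over `ℝ`, entrywise**: `∑_{a'} A a' a A a' c = n² δ_{ac}`. [folklore] -/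
theorem sum_rotR_mul_rotR' (a c : Fin 3) :
    ∑ a', rotR j a' a * rotR j a' c = scaleR j ^ 2 * (if a = c then 1 else 0) := by
  have h := congrFun (congrFun (transpose_mul_rot j) a) c
  rw [Matrix.mul_apply, Matrix.smul_apply, Matrix.one_apply] at h
  simp only [Matrix.transpose_apply, smul_eq_mul] at h
  have h' : ((∑ a', rot j a' a * rot j a' c : ℤ) : ℝ) = ((rotScale j ^ 2 * (if a = c then 1 else 0) : ℤ) : ℝ) := by
    exact_mod_cast h
  push_cast at h'
  simpa [rotR, scaleR] using h'

/-- The real matrix `A_j` as a `Matrix`. [folklore] -/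
def rotM : Matrix (Fin 3) (Fin 3) ℝ := Matrix.of fun a b => rotR j a b

/-- Entries of `rotM`. [folklore] -/
@[simp] theorem rotM_apply (a b : Fin 3) : rotM j a b = rotR j a b := rfl

/-- `A_j A_jᵀ = n_j² Id` in `Matrix (Fin 3) (Fin 3) ℝ`. [folklore] -/
theorem rotM_mul_transpose : rotM j * (rotM j)ᵀ = (scaleR j ^ 2) • (1 : Matrix (Fin 3) (Fin 3) ℝ) := by
  ext a c
  rw [Matrix.mul_apply, Matrix.smul_apply, Matrix.one_apply, smul_eq_mul]
  simp only [Matrix.transpose_apply, rotM_apply]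
  exact sum_rotR_mul_rotR j a c

/-- The six base directions as real vectors. [folklore] -/
def baseSix (i : Fin 6) (a : Fin 3) : ℝ := ((sixDir i a : ℤ) : ℝ)

/-- The six directions `A_j fᵢ` of the family `𝓕^{j,R}` as real vectors. [cite: DelellisKwon2022, §3.1] -/
def famDir (i : Fin 6) : Fin 3 → ℝ := rotM j *ᵥ baseSix i

/-- `(A_j fᵢ)_a = ∑_{a'} A a a' (fᵢ)_{a'}`. [folklore] -/
theorem famDir_apply (i : Fin 6) (a : Fin 3) : famDir j i a = ∑ a', rotR j a a' * ((sixDir i a' : ℤ) : ℝ) := by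
  simp [famDir, Matrix.mulVec, dotProduct, baseSix]

/-- `famDir j i` is the real vector of `dir (j, i)`. [folklore] -/
theorem famDir_eq_dir (i : Fin 6) (a : Fin 3) : famDir j i a = ((dir (j, Fin.castLE (by norm_num) i) a : ℤ) : ℝ) := by
  rw [famDir_apply, dir_eq_mulVec, baseDir_castLE, Matrix.mulVec, dotProduct]
  push_cast
  simp [rotR]

/-- `𝕄 = Matrix (Fin 3) (Fin 3) ℝ`, local notation. -/
local notation "𝕄" => Matrix (Fin 3) (Fin 3) ℝ

/-- The congruence `M ↦ A_jᵀ M A_j` on matrices. [folklore] -/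
def congM (M : 𝕄) : 𝕄 := (rotM j)ᵀ * M * rotM j

/-- The congruence preserves symmetry. [folklore] -/
theorem congM_transpose {M : 𝕄} (hMt : Mᵀ = M) : (congM j M)ᵀ = congM j M := by
  rw [congM, Matrix.transpose_mul, Matrix.transpose_mul, Matrix.transpose_transpose, hMt, Matrix.mul_assoc]

/-- **`A_j (A_jᵀ M A_j) A_jᵀ = n_j⁴ M`.** [folklore] -/
theorem rotM_mul_congM_mul_transpose (M : 𝕄) : rotM j * congM j M * (rotM j)ᵀ = (scaleR j ^ 4) • M := by
  have h : rotM j * ((rotM j)ᵀ * M * rotM j) * (rotM j)ᵀ = (rotM j * (rotM j)ᵀ) * M * (rotM j * (rotM j)ᵀ) := by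
    simp only [Matrix.mul_assoc]
  rw [congM, h, rotM_mul_transpose, Matrix.smul_mul, Matrix.mul_smul, Matrix.one_mul, Matrix.mul_one, smul_smul]
  ring_nf

/-- `A (u ⊗ u) Aᵀ = (Au) ⊗ (Au)` entrywise. [folklore] -/
theorem rotM_mul_vecMulVec_mul_transpose (u : Fin 3 → ℝ) :
    rotM j * Matrix.vecMulVec u u * (rotM j)ᵀ = Matrix.vecMulVec (rotM j *ᵥ u) (rotM j *ᵥ u) := by
  ext a b
  simp [Matrix.mul_apply, Matrix.vecMulVec_apply, Matrix.mulVec, dotProduct, Fin.sum_univ_three]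
  ring

/-- Entries of the congruence: `(A_jᵀ M A_j)_{ab} = ∑_{a',b'} A_{a'a} M_{a'b'} A_{b'b}`. [folklore] -/
theorem congM_apply (M : 𝕄) (a b : Fin 3) : congM j M a b = ∑ a', ∑ b', rotR j a' a * M a' b' * rotR j b' b := by
  simp only [congM, Matrix.mul_apply, Matrix.transpose_apply, rotM_apply, Finset.sum_mul]
  rw [Finset.sum_comm]

/-- **The rank-one decomposition for the rotated family (matrix form)**:
`M_ab = ∑ᵢ (Lᵢ(A_jᵀ M A_j)/n_j⁴) (A_j fᵢ)_a (A_j fᵢ)_b` for every symmetric `M`. [cite: DelellisKwon2022, Lemma 3.2 (applied to 𝓕^{j,R})] -/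
theorem fam_identityM {M : 𝕄} (hsym : ∀ a b, M a b = M b a) (a b : Fin 3) :
    M a b = ∑ i, sixCoeffSq (congM j M) i / scaleR j ^ 4 * (famDir j i a * famDir j i b) := by
  have hn : (0 : ℝ) < scaleR j ^ 4 := pow_pos (scaleR_pos j) 4
  have hMt : Mᵀ = M := by ext a' b'; exact hsym b' a'
  have hsym' : ∀ a' b', congM j M a' b' = congM j M b' a' := fun a' b' => by
    have := congrFun (congrFun (congM_transpose j hMt) a') b'
    rw [Matrix.transpose_apply] at this
    exact this.symm
  -- the base identity for the symmetric matrix `M' = Aᵀ M A`, as a matrix identity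
  have hbase : congM j M = ∑ i, sixCoeffSq (congM j M) i • Matrix.vecMulVec (baseSix i) (baseSix i) := by
    ext a' b'
    rw [Matrix.sum_apply, six_identity hsym' a' b']
    exact Finset.sum_congr rfl fun i _ => by simp [Matrix.vecMulVec_apply, baseSix]
  -- conjugate back with `A_j`
  have h := rotM_mul_congM_mul_transpose j M
  rw [hbase, Matrix.mul_sum, Matrix.sum_mul] at h
  simp_rw [Matrix.mul_smul, Matrix.smul_mul, rotM_mul_vecMulVec_mul_transpose] at h
  have hab := congrFun (congrFun h a) b
  simp only [Matrix.sum_apply, Matrix.smul_apply, Matrix.vecMulVec_apply, smul_eq_mul] at hab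
  have hab' : scaleR j ^ 4 * M a b = ∑ i, sixCoeffSq (congM j M) i * (famDir j i a * famDir j i b) := hab.symm
  have : M a b = (∑ i, sixCoeffSq (congM j M) i * (famDir j i a * famDir j i b)) / scaleR j ^ 4 := by
    rw [← hab', mul_comm, mul_div_assoc, div_self hn.ne', mul_one]
  rw [this, Finset.sum_div]
  exact Finset.sum_congr rfl fun i _ => by ring

/-! ## The coefficients as functions on the sup-metric space `Fin 3 → Fin 3 → ℝ` -/

/-- The congruence on the Pi type (sup metric): `cong j M = A_jᵀ M A_j`. [folklore] -/
def cong (M : Fin 3 → Fin 3 → ℝ) : Fin 3 → Fin 3 → ℝ := fun a b => congM j (Matrix.of fun a' b' => M a' b') a b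

/-- Entries of `cong`. [folklore] -/
theorem cong_apply (M : Fin 3 → Fin 3 → ℝ) (a b : Fin 3) : cong j M a b = ∑ a', ∑ b', rotR j a' a * M a' b' * rotR j b' b := by
  rw [cong, congM_apply]; rfl

/-- **The coordinate functionals of the rotated family**: `famCoeffSq j M i = Lᵢ(A_jᵀ M A_j)/n_j⁴`. [cite: DelellisKwon2022, Lemma 3.2 and §3.4.2] -/
def famCoeffSq (M : Fin 3 → Fin 3 → ℝ) (i : Fin 6) : ℝ := sixCoeffSq (cong j M) i / scaleR j ^ 4

/-- **The rank-one decomposition for the rotated family**: `M_ab = ∑ᵢ famCoeffSq j M i (A_j fᵢ)_a (A_j fᵢ)_b`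
for every symmetric `M`. [cite: DelellisKwon2022, Lemma 3.2 (applied to 𝓕^{j,R})] -/
theorem fam_identity {M : Fin 3 → Fin 3 → ℝ} (hsym : ∀ a b, M a b = M b a) (a b : Fin 3) :
    M a b = ∑ i, famCoeffSq j M i * (famDir j i a * famDir j i b) := by
  have h := fam_identityM j (M := Matrix.of fun a' b' => M a' b') (fun a' b' => hsym a' b') a b
  exact h

/-- `Lᵢ` is homogeneous: `Lᵢ(c M) = c Lᵢ(M)`. [folklore] -/
theorem sixCoeffSq_smul (c : ℝ) (M : Fin 3 → Fin 3 → ℝ) (i : Fin 6) :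
    sixCoeffSq (fun a b => c * M a b) i = c * sixCoeffSq M i := by
  fin_cases i <;> simp [sixCoeffSq] <;> ring

/-- `cong` is linear: `cong (M - N) = cong M - cong N` pointwise. [folklore] -/
theorem cong_sub_apply (M N : Fin 3 → Fin 3 → ℝ) (a b : Fin 3) : cong j (M - N) a b = cong j M a b - cong j N a b := by
  simp only [cong_apply, Pi.sub_apply, mul_sub, sub_mul, Finset.sum_sub_distrib]

/-- `cong Id = n² Id`. [folklore] -/
theorem cong_idMat (a b : Fin 3) : cong j idMat a b = scaleR j ^ 2 * idMat a b := by
  rw [cong_apply]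
  unfold idMat
  have h : ∀ a', ∑ b', rotR j a' a * (if a' = b' then (1 : ℝ) else 0) * rotR j b' b = rotR j a' a * rotR j a' b :=
    fun a' => by simp [Finset.sum_ite_eq]
  simp_rw [h]
  rw [sum_rotR_mul_rotR' j a b]

/-- The crude entry bound `K_j = (∑_{a,b} |A_{ab}|)²` of the congruence. [folklore] -/
def congConst : ℝ := (∑ a, ∑ b, |rotR j a b|) ^ 2

/-- `K_j ≥ 1`. [folklore] -/
theorem one_le_congConst : 1 ≤ congConst j := by
  have h1 : (1 : ℝ) ≤ ∑ a, ∑ b, |rotR j a b| := by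
    have hsq := sum_rotR_mul_rotR j 0 0
    simp only [if_true] at hsq
    have hn : (1 : ℝ) ≤ scaleR j ^ 2 := by
      have h1' : (1 : ℝ) ≤ scaleR j := by unfold scaleR; exact_mod_cast rotScale_pos j
      nlinarith
    have hrow : ∑ a', rotR j 0 a' * rotR j 0 a' ≤ (∑ a', |rotR j 0 a'|) ^ 2 := by
      rw [Fin.sum_univ_three, Fin.sum_univ_three]
      nlinarith [abs_nonneg (rotR j 0 0), abs_nonneg (rotR j 0 1), abs_nonneg (rotR j 0 2),
        sq_abs (rotR j 0 0), sq_abs (rotR j 0 1), sq_abs (rotR j 0 2)]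
    have hsub : ∑ a', |rotR j 0 a'| ≤ ∑ a, ∑ b, |rotR j a b| :=
      Finset.single_le_sum (f := fun a => ∑ b, |rotR j a b|) (fun a _ => Finset.sum_nonneg fun b _ => abs_nonneg _)
        (Finset.mem_univ 0)
    have h0 : 0 ≤ ∑ a', |rotR j 0 a'| := Finset.sum_nonneg fun _ _ => abs_nonneg _
    nlinarith [hsq, hrow, hsub]
  unfold congConst
  nlinarith

/-- **Entry bound of the congruence**: `|(A_jᵀ K A_j)_{ab}| ≤ K_j |K|_∞`. [folklore] -/
theorem abs_cong_apply_le {K : Fin 3 → Fin 3 → ℝ} {ρ : ℝ} (hK : ∀ a b, |K a b| ≤ ρ) (a b : Fin 3) :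
    |cong j K a b| ≤ congConst j * ρ := by
  have hρ : 0 ≤ ρ := (abs_nonneg _).trans (hK 0 0)
  rw [cong_apply]
  set S := ∑ a, ∑ b, |rotR j a b| with hS
  have hcol : ∀ c, ∑ a', |rotR j a' c| ≤ S := fun c => by
    rw [hS]
    exact Finset.sum_le_sum fun a' _ => Finset.single_le_sum (f := fun c => |rotR j a' c|)
      (fun _ _ => abs_nonneg _) (Finset.mem_univ c)
  calc |∑ a', ∑ b', rotR j a' a * K a' b' * rotR j b' b|
      ≤ ∑ a', ∑ b', |rotR j a' a * K a' b' * rotR j b' b| :=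
        (Finset.abs_sum_le_sum_abs _ _).trans (Finset.sum_le_sum fun _ _ => Finset.abs_sum_le_sum_abs _ _)
    _ ≤ ∑ a', ∑ b', |rotR j a' a| * ρ * |rotR j b' b| := Finset.sum_le_sum fun a' _ => Finset.sum_le_sum fun b' _ => by
        rw [abs_mul, abs_mul]
        gcongr
        exact hK a' b'
    _ = (∑ a', |rotR j a' a|) * ρ * (∑ b', |rotR j b' b|) := by
        rw [Finset.sum_mul, Finset.sum_mul]
        exact Finset.sum_congr rfl fun a' _ => by rw [Finset.mul_sum]
    _ ≤ S * ρ * S := by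
        have h0 : 0 ≤ ∑ b', |rotR j b' b| := Finset.sum_nonneg fun _ _ => abs_nonneg _
        have hS0 : 0 ≤ S := Finset.sum_nonneg fun _ _ => Finset.sum_nonneg fun _ _ => abs_nonneg _
        exact mul_le_mul (mul_le_mul_of_nonneg_right (hcol a) hρ) (hcol b) h0 (mul_nonneg hS0 hρ)
    _ = congConst j * ρ := by unfold congConst; ring

/-- **The Lipschitz bound**: `|famCoeffSq j M i - 1/(4n_j²)| ≤ (5 K_j /(4 n_j⁴)) |M - Id|_∞`. [cite: DelellisKwon2022, Lemma 3.2 (proof: L_i near Id)] -/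
theorem abs_famCoeffSq_sub_le {M : Fin 3 → Fin 3 → ℝ} {ρ : ℝ} (hM : dist M idMat ≤ ρ) (i : Fin 6) :
    |famCoeffSq j M i - 1 / (4 * scaleR j ^ 2)| ≤ 5 * congConst j / (4 * scaleR j ^ 4) * ρ := by
  have hn := scaleR_pos j
  have hn2 : 0 < scaleR j ^ 2 := by positivity
  have hρ : 0 ≤ ρ := dist_nonneg.trans hM
  -- the normalised congruent matrix `M₁ = (Aᵀ M A)/n²`
  set M₁ : Fin 3 → Fin 3 → ℝ := fun a b => cong j M a b / scaleR j ^ 2 with hM₁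
  have hcong : cong j M = fun a b => scaleR j ^ 2 * M₁ a b := by
    funext a b; rw [hM₁]; field_simp
  -- entries of `M₁ - Id` are small
  have hentry : ∀ a b, |M₁ a b - idMat a b| ≤ congConst j / scaleR j ^ 2 * ρ := by
    intro a b
    have hK : ∀ a b, |(M - idMat : Fin 3 → Fin 3 → ℝ) a b| ≤ ρ := fun a b => by
      simpa [Pi.sub_apply] using abs_sub_idMat_le hM a b
    have h1 : M₁ a b - idMat a b = cong j (M - idMat) a b / scaleR j ^ 2 := by
      rw [cong_sub_apply, cong_idMat, hM₁]
      field_simp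
    rw [h1, abs_div, abs_of_pos hn2, div_mul_eq_mul_div, le_div_iff₀ hn2, div_mul_cancel₀ _ hn2.ne']
    exact abs_cong_apply_le j hK a b
  have hdist : dist M₁ idMat ≤ congConst j / scaleR j ^ 2 * ρ := by
    have h0 : 0 ≤ congConst j / scaleR j ^ 2 * ρ := by
      have := one_le_congConst j; positivity
    refine (dist_pi_le_iff h0).2 fun a => (dist_pi_le_iff h0).2 fun b => ?_
    rw [Real.dist_eq]; exact hentry a b
  have hL := abs_sixCoeffSq_sub_le hdist i
  -- `famCoeffSq = L_i(M₁)/n²`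
  have hf : famCoeffSq j M i = sixCoeffSq M₁ i / scaleR j ^ 2 := by
    unfold famCoeffSq
    rw [hcong, sixCoeffSq_smul]
    field_simp
  rw [hf, show sixCoeffSq M₁ i / scaleR j ^ 2 - 1 / (4 * scaleR j ^ 2) = (sixCoeffSq M₁ i - 1 / 4) / scaleR j ^ 2 by
    field_simp, abs_div, abs_of_pos hn2, div_le_iff₀ hn2]
  calc |sixCoeffSq M₁ i - 1 / 4| ≤ 5 / 4 * (congConst j / scaleR j ^ 2 * ρ) := hL
    _ = 5 * congConst j / (4 * scaleR j ^ 4) * ρ * scaleR j ^ 2 := by field_simp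

/-- `famCoeffSq j Id i = 1/(4n_j²)` (`= 1/C_j`). [cite: DelellisKwon2022, Lemma 3.2 (L_i(Id) = 1/C)] -/
theorem famCoeffSq_idMat (i : Fin 6) : famCoeffSq j idMat i = 1 / (4 * scaleR j ^ 2) := by
  have h := abs_famCoeffSq_sub_le j (M := idMat) (ρ := 0) (by rw [dist_self]) i
  rw [mul_zero, abs_nonpos_iff, sub_eq_zero] at h
  exact h

/-- The radius `ρ_j = n_j²/(10 K_j)` of the sup-ball on which the family coefficients are `≥ 1/(8n_j²)`. [folklore] -/
def famRadius : ℝ := scaleR j ^ 2 / (10 * congConst j)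

/-- `ρ_j > 0`. [folklore] -/
theorem famRadius_pos : 0 < famRadius j := by
  have := one_le_congConst j; have := scaleR_pos j; unfold famRadius; positivity

/-- **`famCoeffSq ≥ 1/(8n_j²)` on `|M - Id|_∞ ≤ ρ_j`.** [cite: DelellisKwon2022, Lemma 3.2 (L_i ≥ 1/(2C))] -/
theorem le_famCoeffSq {M : Fin 3 → Fin 3 → ℝ} (hM : dist M idMat ≤ famRadius j) (i : Fin 6) :
    1 / (8 * scaleR j ^ 2) ≤ famCoeffSq j M i := by
  have h := abs_famCoeffSq_sub_le j hM i
  have hn := scaleR_pos j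
  have hK := one_le_congConst j
  have hval : 5 * congConst j / (4 * scaleR j ^ 4) * famRadius j = 1 / (8 * scaleR j ^ 2) := by
    unfold famRadius; field_simp; ring
  rw [hval] at h
  have := (abs_le.1 h).1
  have h8 : 1 / (8 * scaleR j ^ 2) + 1 / (8 * scaleR j ^ 2) = 1 / (4 * scaleR j ^ 2) := by
    field_simp; ring
  linarith

/-- `famCoeffSq > 0` on the open sup-ball `|M - Id|_∞ < 2ρ_j`. [folklore] -/
theorem famCoeffSq_pos {M : Fin 3 → Fin 3 → ℝ} (hM : dist M idMat < 2 * famRadius j) (i : Fin 6) :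
    0 < famCoeffSq j M i := by
  have h := abs_famCoeffSq_sub_le j (le_rfl : dist M idMat ≤ dist M idMat) i
  have hn := scaleR_pos j
  have hK := one_le_congConst j
  have hlt : 5 * congConst j / (4 * scaleR j ^ 4) * dist M idMat < 1 / (4 * scaleR j ^ 2) := by
    have hval : 5 * congConst j / (4 * scaleR j ^ 4) * (2 * famRadius j) = 1 / (4 * scaleR j ^ 2) := by
      unfold famRadius; field_simp; ring
    rw [← hval]
    exact mul_lt_mul_of_pos_left hM (by positivity)
  have := (abs_le.1 h).1
  linarith

/-- The coefficients `Γ_{j,i} = √(famCoeffSq j · i)`. [cite: DelellisKwon2022, Lemma 3.2 (Γ = √L)] -/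
def famCoeff (i : Fin 6) (M : Fin 3 → Fin 3 → ℝ) : ℝ := Real.sqrt (famCoeffSq j M i)

/-- `Γ² = famCoeffSq` on `|M - Id|_∞ ≤ 2ρ_j`. [folklore] -/
theorem famCoeff_sq {M : Fin 3 → Fin 3 → ℝ} (hM : dist M idMat ≤ 2 * famRadius j) (i : Fin 6) :
    famCoeff j i M ^ 2 = famCoeffSq j M i := by
  have h := abs_famCoeffSq_sub_le j hM i
  have hn := scaleR_pos j
  have hK := one_le_congConst j
  have hval : 5 * congConst j / (4 * scaleR j ^ 4) * (2 * famRadius j) = 1 / (4 * scaleR j ^ 2) := by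
    unfold famRadius; field_simp; ring
  rw [hval] at h
  have := (abs_le.1 h).1
  exact Real.sq_sqrt (by linarith)

/-- `Γ > 0` on the open sup-ball of radius `2ρ_j`. [folklore] -/
theorem famCoeff_pos {M : Fin 3 → Fin 3 → ℝ} (hM : dist M idMat < 2 * famRadius j) (i : Fin 6) :
    0 < famCoeff j i M := Real.sqrt_pos.2 (famCoeffSq_pos j hM i)

/-- **The decomposition with genuine squares** on `|M - Id|_∞ ≤ 2ρ_j`:
`M_ab = ∑ᵢ Γ_{j,i}(M)² (A_j fᵢ)_a (A_j fᵢ)_b`. [cite: DelellisKwon2022, Lemma 3.2 (applied to 𝓕^{j,R})] -/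
theorem fam_decomposition {M : Fin 3 → Fin 3 → ℝ} (hsym : ∀ a b, M a b = M b a)
    (hM : dist M idMat ≤ 2 * famRadius j) (a b : Fin 3) :
    M a b = ∑ i, famCoeff j i M ^ 2 * (famDir j i a * famDir j i b) := by
  rw [fam_identity j hsym a b]
  exact Finset.sum_congr rfl fun i _ => by rw [famCoeff_sq j hM i]

/-- The entries of the congruence are smooth (linear) in `M`. [folklore] -/
theorem contDiff_cong_apply (a b : Fin 3) {n : WithTop ℕ∞} : ContDiff ℝ n fun M : Fin 3 → Fin 3 → ℝ => cong j M a b := by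
  have hexp : (fun M : Fin 3 → Fin 3 → ℝ => cong j M a b) =
      fun M => ∑ a', ∑ b', rotR j a' a * M a' b' * rotR j b' b := funext fun M => cong_apply j M a b
  rw [hexp]
  refine ContDiff.sum fun a' _ => ContDiff.sum fun b' _ => ?_
  have he : ContDiff ℝ n fun M : Fin 3 → Fin 3 → ℝ => M a' b' :=
    (contDiff_apply ℝ ℝ b').comp (contDiff_apply ℝ (Fin 3 → ℝ) a')
  exact (contDiff_const.mul he).mul contDiff_const

/-- The congruence is smooth as a map of matrices. [folklore] -/
theorem contDiff_cong {n : WithTop ℕ∞} : ContDiff ℝ n (cong j) :=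
  contDiff_pi.2 fun a => contDiff_pi.2 fun b => contDiff_cong_apply j a b

/-- `famCoeffSq` is smooth in `M`. [folklore] -/
theorem contDiff_famCoeffSq (i : Fin 6) {n : WithTop ℕ∞} : ContDiff ℝ n fun M : Fin 3 → Fin 3 → ℝ => famCoeffSq j M i :=
  ((contDiff_sixCoeffSq i).comp (contDiff_cong j)).div_const _

/-- **`Γ_{j,i}` is smooth on the open sup-ball `|M - Id|_∞ < 2ρ_j`.** [cite: DelellisKwon2022, Lemma 3.2 (Γ ∈ C^∞)] -/
theorem contDiffOn_famCoeff (i : Fin 6) {n : WithTop ℕ∞} :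
    ContDiffOn ℝ n (famCoeff j i) (ball (idMat : Fin 3 → Fin 3 → ℝ) (2 * famRadius j)) :=
  (contDiff_famCoeffSq j i).contDiffOn.sqrt fun _ hM => (famCoeffSq_pos j (mem_ball.mp hM) i).ne'

/-- **Uniform bounds on all derivatives of `Γ_{j,i}` on `|M - Id|_∞ ≤ ρ_j`** ("the smoothness of the selected
functions depends only on" the family). [cite: DelellisKwon2022, Lemma 3.2 and §3.4.2] -/
theorem exists_bound_iteratedFDeriv_famCoeff (i : Fin 6) (m : ℕ) :
    ∃ C : ℝ, ∀ M : Fin 3 → Fin 3 → ℝ, dist M idMat ≤ famRadius j → ‖iteratedFDeriv ℝ m (famCoeff j i) M‖ ≤ C := by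
  set U : Set (Fin 3 → Fin 3 → ℝ) := ball idMat (2 * famRadius j) with hU
  have hUopen : IsOpen U := isOpen_ball
  have hsmooth : ContDiffOn ℝ ∞ (famCoeff j i) U := contDiffOn_famCoeff j i
  have hcont : ContinuousOn (iteratedFDerivWithin ℝ m (famCoeff j i) U) U :=
    hsmooth.continuousOn_iteratedFDerivWithin (by exact_mod_cast le_top) hUopen.uniqueDiffOn
  have hcont' : ContinuousOn (iteratedFDeriv ℝ m (famCoeff j i)) U :=
    hcont.congr fun M hM => (iteratedFDerivWithin_of_isOpen m hUopen hM).symm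
  have hsub : closedBall idMat (famRadius j) ⊆ U := by
    intro M hM
    rw [hU, mem_ball]
    exact (mem_closedBall.mp hM).trans_lt (by linarith [famRadius_pos j])
  obtain ⟨C, hC⟩ := (isCompact_closedBall (idMat : Fin 3 → Fin 3 → ℝ) (famRadius j)).exists_bound_of_continuousOn
    (hcont'.mono hsub)
  exact ⟨C, fun M hM => hC M (mem_closedBall.mpr hM)⟩

end DLK

end Literature.Analysis.FluidPDE
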